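/-
COR-CM (cells pub-hodgecm / pub-hodgecm2, stage 2 of the Hodge ladder) — TRANSPOSITION item (vi), S-LANE CARRIERS-PLAN steps S6 × S7: the one-object
re-cut `Transposition/Item6SupplyPinnedAssemblyAlongHoldsRestOne.lean` (pin-3, S7 first re-cut) WITH THE POSITED `rhoΩ` REPLACED BY THE HECKE ACTION
CONSTRUCTED in `Liu2021/AppendixC/RestOneHecke.lean` (hcomp-shimura, S6): the display's Hecke-side datum is now a family of Hecke TRANSLATES
`T : ∀ F ι₁ V Φ, 6 ≤ [F:ℚ] → (C F ι₁ V Φ).HeckeTranslates` on the compactified Shimura system of the §4.2 datum ([Milne2005ShimuraVarieties] Def. 12.10 (a),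
§13 Thm. 13.6; [Liu2021] §4.2 l. 2074), and `hLiu`/`hirr`/`hsm` read the rest at `(T F ι₁ V Φ h6).rhoΩOne …` = the representation of `𝔾(𝔸_F^∞)` on
`Ω(μ)` «`M_μ`-linearly via its action on `A_∞`» ([Liu2021] Def. 4.16 l. 2219) — so `res_K` lands in `Ω(μ)^K` BY CONSTRUCTION (`restOne_rhoΩ_res_of_mem`,
the ⊆ half of Thm. 4.18 (1) l. 2239).  pin-3 = prover-pub-hodgecm2-pin-3-g3-0 (CARRIERS-PLAN S7 owner, single writer of `Transposition/Item6*`); BYTES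
DRAFTED by hcomp-shimura gen 11 (prover-pub-hodgecm2-hcomp-shimura-g11-0, author of the S6 socket `RestOneHecke.lean`) and filed by pin-3 with this
header sentence as the only change; theorems only; nothing landed is edited or restated (NEW path, FILE-ONCE).  RED-TEAM WATCHES carried from the
first re-cut (TGTBT D18.3 item 1: `P` is a FREE token family; D21 row e: `rhoΩ` is NO LONGER a posited binder here — every displayed hypothesis
reads the CONSTRUCTED `(T F ι₁ V Φ h6).rhoΩOne …`; the proof's total family takes the value `1` only off the guard `6 ≤ [F:ℚ]`, a branch no
hypothesis reads).  FRAMING: HC_CM is NOT proved; S2 = B01-S is NOT inhabited; `iso`, `C`, `P`, the generic carriers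
`Eps … rho` and `T` are POSITED (after S5 + `HComp/HeckeTranslatesOfSec42DataOf`: `C := sec42DataOf …`, `T := heckeTranslatesFamilyOf hU7 …` by application).
-/
import Summits.HodgeConjecture.CorCM.B01.Transposition.Item6SupplyPinnedAssemblyAlongHoldsRestOne
import Literature.NumberTheory.Automorphic.Liu2021.AppendixC.RestOneHecke
import HarnessLib

set_option autoImplicit false

/-!
# B01-S and the (β)-free END display at `R := (T …).restOne …` — the Hecke action on `Ω(μ)` CONSTRUCTED (S6 × S7)

KERNEL: the first re-cut `faceSupply_of_thm418AsPrinted_along_conj_holds_restOne` at the total family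
`rhoΩ' := fun F ι₁ V Φ ↦ if h6 : 6 ≤ [F:ℚ] then (T F ι₁ V Φ h6).rhoΩOne … else 1` with `rw [dif_pos h6]` inside the three guarded hypotheses; no auxiliary
definition.  Probe of record (everything inlined): `HOME/pinning/hcomp/hcomp-shimura/probes/OmegaHeckeDirectProbe.g11-da93592775a5.lean` rc 0 · 0 sorry · trio.
HC_CM is NOT proved.

References: Y. Liu, arXiv:2102.11518 = Camb. J. Math. 9 (2021) (`FJcycle.tex` md5 6db49a74122d): §4.2 l. 2070–2074, Def. 4.16–Rem. 4.17 l. 2218–2227,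
Thm. 4.18 l. 2232–2245.  J. S. Milne, *Introduction to Shimura varieties* (2005): Def. 5.14, §5 p. 57–58, Def. 12.10 (a) p. 115, §13 p. 118 (Thm. 13.6).
-/

noncomputable section

open scoped TensorProduct InnerProductSpace

namespace Summit.HodgeConjecture.CorCM.Model

open CategoryTheory CategoryTheory.Limits AlgebraicGeometry NumberField
open Literature.AlgebraicGeometry.Motives
open Literature.AlgebraicGeometry.HodgeTheory
open Literature.AlgebraicGeometry.ShimuraVarieties
open Literature.AlgebraicGeometry.ShimuraVarieties.UnitaryCanonicalModel
open Literature.AlgebraicGeometry.ComplexMultiplication (IsCMTypeRealisation)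
open Literature.NumberTheory.ComplexMultiplication
open Literature.NumberTheory.Automorphic
open Literature.NumberTheory.Automorphic.IdeleClassGroup
open Literature.NumberTheory.Automorphic.PicardCM
open Literature.NumberTheory.Automorphic.Liu2021
open Literature.NumberTheory.Automorphic.Liu2021.AppendixC
open Literature.NumberTheory.Automorphic.Liu2021.AppendixC.RestOne
open Summit.HodgeConjecture.CorCM.Transposition

/-! ## §1  B01-S and the END display at the first re-cut WITH THE HECKE ACTION CONSTRUCTED (S6 socket, def-free) -/

/-- **S6 SOCKET, B01-S level, over pin-3's first re-cut** (`faceSupply_of_thm418AsPrinted_along_conj_holds_restOne`, v3 086bd8b8bf42 = v2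
0faf0ce8f2a5 statements): the posited binder `rhoΩ` (a FREE `M_μ`-representation on `Ω(μ)`) REPLACED by
`T : ∀ F ι₁ V Φ, 6 ≤ [F:ℚ] → (C F ι₁ V Φ).HeckeTranslates` ([Milne2005ShimuraVarieties] Def. 12.10 (a) / Thm. 13.6; [Liu2021] §4.2 l. 2074),
the slot `rhoΩ F ι₁ V Φ` of `hLiu`/`hirr`/`hsm` now READING `(T F ι₁ V Φ h6).rhoΩOne …` = the representation of `𝔾(𝔸_F^∞)` on `Ω(μ)` «`M_μ`-linearly
via its action on `A_∞`» ([Liu2021] Def. 4.16 l. 2219; S6b `RestOneHecke.lean`: `rhoΩOne_resOne`, `_of_mem` = the ⊆ half of Thm. 4.18 (1)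
l. 2239 by construction), the guard `6 ≤ [F:ℚ]` becoming the named binder `h6` of those three hypotheses (α-equivalent for every consumer).
NO auxiliary definition.  Proof: the first re-cut at the total family `rhoΩ' := fun … ↦ if h6 : 6 ≤ [F:ℚ] then (T F ι₁ V Φ h6).rhoΩOne … else 1`
and `rw [dif_pos h6]` inside `hLiu`/`hirr`/`hsm` — the transport happens HERE, at the GENERIC carriers `Eps … rho` (small terms), never at the
ω terms.  HC_CM is NOT proved: no hypothesis is inhabited here.
[cite: Liu2021, Thm. 4.18 (FJcycle.tex l. 2232–2245), Def. 4.16 l. 2218–2224, §4.2 l. 2070–2074] [cite: Milne2005ShimuraVarieties, Def. 12.10 (a) p. 115; Thm. 13.6 p. 118] -/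
theorem faceSupply_of_thm418AsPrinted_along_conj_holds_restOne_hecke
    (hHD : exists_isReal_hodgeModel) (hI : hodgePQ_independent_of_hodgeModel)
    (h₁ : BallQuotientUniformised) (h₃ : CMAbelianVarietyRealised)
    (h : exists_recordSystem) (hA : albanese_baseChange_isLimit_fan_jacobian)
    (iso : ∀ (F : CMField) (ι₁ : F →+* ℂ) (_ : HermSpace3 F ι₁) (_ : CMType F), ℕ → Prop)
    (C : ∀ (F : CMField) (ι₁ : F →+* ℂ) (V : HermSpace3 F ι₁) (Φ : CMType F), Sec42Data (honestP5Of h F ι₁ V Φ) (iso F ι₁ V Φ))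
    (P : ∀ (F : CMField) [IsGalois ℚ F] (ι₁ : F →+* ℂ) (_ : HermSpace3 F ι₁) (Φ : CMType F) (A : AbelianVariety F),
      (muAlgValueField F (muOfInvType ι₁ Φ) →+* A.endAlgebra) → Type)
    (Eps : ∀ (F : CMField) (ι₁ : F →+* ℂ) (_ : HermSpace3 F ι₁) (_ : CMType F), Type)
    (epsOf : ∀ (F : CMField) (ι₁ : F →+* ℂ) (V : HermSpace3 F ι₁) (Φ : CMType F), F → Eps F ι₁ V Φ)
    (Chi : ∀ (F : CMField) (ι₁ : F →+* ℂ) (_ : HermSpace3 F ι₁) (_ : CMType F), Type)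
    (omega : ∀ (F : CMField) (ι₁ : F →+* ℂ) (V : HermSpace3 F ι₁) (Φ : CMType F), Eps F ι₁ V Φ → Chi F ι₁ V Φ → Type)
    [instACG : ∀ (F : CMField) (ι₁ : F →+* ℂ) (V : HermSpace3 F ι₁) (Φ : CMType F) (ε : Eps F ι₁ V Φ) (χ : Chi F ι₁ V Φ),
      AddCommGroup (omega F ι₁ V Φ ε χ)]
    [instMod : ∀ (F : CMField) (ι₁ : F →+* ℂ) (V : HermSpace3 F ι₁) (Φ : CMType F) (ε : Eps F ι₁ V Φ) (χ : Chi F ι₁ V Φ),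
      Module ℂ (omega F ι₁ V Φ ε χ)]
    (rho : ∀ (F : CMField) (ι₁ : F →+* ℂ) (V : HermSpace3 F ι₁) (Φ : CMType F) (ε : Eps F ι₁ V Φ) (χ : Chi F ι₁ V Φ),
      Representation ℂ (C F ι₁ V Φ).G (omega F ι₁ V Φ ε χ))
    (T : ∀ (F : CMField) (ι₁ : F →+* ℂ) (V : HermSpace3 F ι₁) (Φ : CMType F), 6 ≤ Module.finrank ℚ F →
      (C F ι₁ V Φ).HeckeTranslates)
    (hLiu : ∀ (F : CMField) [IsGalois ℚ F] (h6 : 6 ≤ Module.finrank ℚ F) (Φ : CMType F) (ι₁ : F →+* ℂ), ι₁ ∈ Φ.1 →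
      ∀ V : HermSpace3 F ι₁, Thm418AsPrintedC (C F ι₁ V Φ)
        (restOne (C F ι₁ V Φ) (AlgHom.id ℚ F) ι₁ (isConjugateSymplectic_muOfInvType ι₁ Φ) (hasWeight_one_muOfInvType ι₁ Φ) (Def45.Carriers.ofPolDR (muOfInvType ι₁ Φ) (P F ι₁ V Φ))
          (Eps F ι₁ V Φ) (epsOf F ι₁ V Φ) (Chi F ι₁ V Φ) (omega F ι₁ V Φ) (rho F ι₁ V Φ) ((T F ι₁ V Φ h6).rhoΩOne (AlgHom.id ℚ F) ι₁ (isConjugateSymplectic_muOfInvType ι₁ Φ) (hasWeight_one_muOfInvType ι₁ Φ) (Def45.Carriers.ofPolDR (muOfInvType ι₁ Φ) (P F ι₁ V Φ)))))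
    (hObj : ∀ (F : CMField) [IsGalois ℚ F], 6 ≤ Module.finrank ℚ F → ∀ (Φ : CMType F) (ι₁ : F →+* ℂ), ι₁ ∈ Φ.1 →
      ∀ V : HermSpace3 F ι₁,
        Nonempty (Def45.CMDatum (AlgHom.id ℚ F) ι₁ (isConjugateSymplectic_muOfInvType ι₁ Φ) (hasWeight_one_muOfInvType ι₁ Φ) (Def45.Carriers.ofPolDR (muOfInvType ι₁ Φ) (P F ι₁ V Φ))))
    (hChi : ∀ (F : CMField), IsGalois ℚ F → 6 ≤ Module.finrank ℚ F → ∀ (Φ : CMType F) (ι₁ : F →+* ℂ), ι₁ ∈ Φ.1 →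
      ∀ V : HermSpace3 F ι₁, Nonempty (Chi F ι₁ V Φ))
    (hirr : ∀ (F : CMField) [IsGalois ℚ F] (h6 : 6 ≤ Module.finrank ℚ F) (Φ : CMType F) (ι₁ : F →+* ℂ), ι₁ ∈ Φ.1 →
      ∀ (V : HermSpace3 F ι₁)
        (i : (toThm418Data (C F ι₁ V Φ)
          (restOne (C F ι₁ V Φ) (AlgHom.id ℚ F) ι₁ (isConjugateSymplectic_muOfInvType ι₁ Φ) (hasWeight_one_muOfInvType ι₁ Φ) (Def45.Carriers.ofPolDR (muOfInvType ι₁ Φ) (P F ι₁ V Φ))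
            (Eps F ι₁ V Φ) (epsOf F ι₁ V Φ) (Chi F ι₁ V Φ) (omega F ι₁ V Φ) (rho F ι₁ V Φ) ((T F ι₁ V Φ h6).rhoΩOne (AlgHom.id ℚ F) ι₁ (isConjugateSymplectic_muOfInvType ι₁ Φ) (hasWeight_one_muOfInvType ι₁ Φ) (Def45.Carriers.ofPolDR (muOfInvType ι₁ Φ) (P F ι₁ V Φ))))).AdmIndex),
        (rho F ι₁ V Φ i.1.1 i.1.2).IsIrreducible)
    (hsm : ∀ (F : CMField) [IsGalois ℚ F] (h6 : 6 ≤ Module.finrank ℚ F) (Φ : CMType F) (ι₁ : F →+* ℂ), ι₁ ∈ Φ.1 →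
      ∀ (V : HermSpace3 F ι₁)
        (i : (toThm418Data (C F ι₁ V Φ)
          (restOne (C F ι₁ V Φ) (AlgHom.id ℚ F) ι₁ (isConjugateSymplectic_muOfInvType ι₁ Φ) (hasWeight_one_muOfInvType ι₁ Φ) (Def45.Carriers.ofPolDR (muOfInvType ι₁ Φ) (P F ι₁ V Φ))
            (Eps F ι₁ V Φ) (epsOf F ι₁ V Φ) (Chi F ι₁ V Φ) (omega F ι₁ V Φ) (rho F ι₁ V Φ) ((T F ι₁ V Φ h6).rhoΩOne (AlgHom.id ℚ F) ι₁ (isConjugateSymplectic_muOfInvType ι₁ Φ) (hasWeight_one_muOfInvType ι₁ Φ) (Def45.Carriers.ofPolDR (muOfInvType ι₁ Φ) (P F ι₁ V Φ))))).AdmIndex)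
        (v : omega F ι₁ V Φ i.1.1 i.1.2),
        ∃ S : Subgroup (C F ι₁ V Φ).G, IsOpen (S : Set (C F ι₁ V Φ).G) ∧ ∀ k ∈ S, rho F ι₁ V Φ i.1.1 i.1.2 k v = v) :
    (picardCMUniverse hHD hI h₁ h₃).FaceSupply := by
  classical
  -- the first re-cut's total family `rhoΩ`, INSTANTIATED from the Hecke translates on the `6 ≤ [F:ℚ]` branch (the only branch read)
  let rhoΩ' : ∀ (F : CMField) [IsGalois ℚ F] (ι₁ : F →+* ℂ) (V : HermSpace3 F ι₁) (Φ : CMType F),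
      Representation (fieldOfValues F (muOfInvType ι₁ Φ)) (C F ι₁ V Φ).G
        (ΩOne (C F ι₁ V Φ) (AlgHom.id ℚ F) ι₁ (isConjugateSymplectic_muOfInvType ι₁ Φ) (hasWeight_one_muOfInvType ι₁ Φ)
          (Def45.Carriers.ofPolDR (muOfInvType ι₁ Φ) (P F ι₁ V Φ))) := fun F _ ι₁ V Φ =>
    if h6 : 6 ≤ Module.finrank ℚ F then
      (T F ι₁ V Φ h6).rhoΩOne (AlgHom.id ℚ F) ι₁ (isConjugateSymplectic_muOfInvType ι₁ Φ) (hasWeight_one_muOfInvType ι₁ Φ)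
        (Def45.Carriers.ofPolDR (muOfInvType ι₁ Φ) (P F ι₁ V Φ))
    else 1
  have hρ : ∀ (F : CMField) [IsGalois ℚ F] (ι₁ : F →+* ℂ) (V : HermSpace3 F ι₁) (Φ : CMType F) (h6 : 6 ≤ Module.finrank ℚ F),
      rhoΩ' F ι₁ V Φ =
        (T F ι₁ V Φ h6).rhoΩOne (AlgHom.id ℚ F) ι₁ (isConjugateSymplectic_muOfInvType ι₁ Φ) (hasWeight_one_muOfInvType ι₁ Φ)
          (Def45.Carriers.ofPolDR (muOfInvType ι₁ Φ) (P F ι₁ V Φ)) := fun F _ ι₁ V Φ h6 => dif_pos h6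
  refine faceSupply_of_thm418AsPrinted_along_conj_holds_restOne hHD hI h₁ h₃ h hA iso C P Eps epsOf Chi omega rho rhoΩ'
    ?_ hObj hChi ?_ ?_
  · intro F hG h6 Φ ι₁ hι V
    rw [hρ F ι₁ V Φ h6]
    exact hLiu F h6 Φ ι₁ hι V
  · intro F hG h6 Φ ι₁ hι V
    rw [hρ F ι₁ V Φ h6]
    exact hirr F h6 Φ ι₁ hι V
  · intro F hG h6 Φ ι₁ hι V
    rw [hρ F ι₁ V Φ h6]
    exact hsm F h6 Φ ι₁ hι V

section MeetingFormHecke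

open MeasureTheory
open Prior.Perl34File (Perl34.IsolationSetting)
open Prior.Perl34File.Perl34

/-- **END DISPLAY, (β)-FREE MEETING FORM, over the first re-cut WITH THE HECKE ACTION, DEF-FREE** (`let U := U_rec`): data {iso, C, P, Eps,
epsOf, Chi, omega (+2 inst), rho, T}; Prop {h, hA, hLiu, hObj, hChi, hirr, hsm} + hM; composed BY NAME from §1's B01-S theorem exactly as the
first re-cut's §2.  HC_CM is NOT proved: no hypothesis is inhabited here.
[cite: Liu2021, Thm. 4.18 (FJcycle.tex l. 2232–2245), Def. 4.16 l. 2219] [cite: Milne2005ShimuraVarieties, Thm. 13.6 p. 118] -/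
theorem hc_cm_of_thm418AsPrinted_along_conj_holds_restOne_hecke_meeting_rec
    (h : exists_recordSystem) (hA : albanese_baseChange_isLimit_fan_jacobian)
    (iso : ∀ (F : CMField) (ι₁ : F →+* ℂ) (_ : HermSpace3 F ι₁) (_ : CMType F), ℕ → Prop)
    (C : ∀ (F : CMField) (ι₁ : F →+* ℂ) (V : HermSpace3 F ι₁) (Φ : CMType F), Sec42Data (honestP5Of h F ι₁ V Φ) (iso F ι₁ V Φ))
    (P : ∀ (F : CMField) [IsGalois ℚ F] (ι₁ : F →+* ℂ) (_ : HermSpace3 F ι₁) (Φ : CMType F) (A : AbelianVariety F),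
      (muAlgValueField F (muOfInvType ι₁ Φ) →+* A.endAlgebra) → Type)
    (Eps : ∀ (F : CMField) (ι₁ : F →+* ℂ) (_ : HermSpace3 F ι₁) (_ : CMType F), Type)
    (epsOf : ∀ (F : CMField) (ι₁ : F →+* ℂ) (V : HermSpace3 F ι₁) (Φ : CMType F), F → Eps F ι₁ V Φ)
    (Chi : ∀ (F : CMField) (ι₁ : F →+* ℂ) (_ : HermSpace3 F ι₁) (_ : CMType F), Type)
    (omega : ∀ (F : CMField) (ι₁ : F →+* ℂ) (V : HermSpace3 F ι₁) (Φ : CMType F), Eps F ι₁ V Φ → Chi F ι₁ V Φ → Type)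
    [instACG : ∀ (F : CMField) (ι₁ : F →+* ℂ) (V : HermSpace3 F ι₁) (Φ : CMType F) (ε : Eps F ι₁ V Φ) (χ : Chi F ι₁ V Φ),
      AddCommGroup (omega F ι₁ V Φ ε χ)]
    [instMod : ∀ (F : CMField) (ι₁ : F →+* ℂ) (V : HermSpace3 F ι₁) (Φ : CMType F) (ε : Eps F ι₁ V Φ) (χ : Chi F ι₁ V Φ),
      Module ℂ (omega F ι₁ V Φ ε χ)]
    (rho : ∀ (F : CMField) (ι₁ : F →+* ℂ) (V : HermSpace3 F ι₁) (Φ : CMType F) (ε : Eps F ι₁ V Φ) (χ : Chi F ι₁ V Φ),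
      Representation ℂ (C F ι₁ V Φ).G (omega F ι₁ V Φ ε χ))
    (T : ∀ (F : CMField) (ι₁ : F →+* ℂ) (V : HermSpace3 F ι₁) (Φ : CMType F), 6 ≤ Module.finrank ℚ F →
      (C F ι₁ V Φ).HeckeTranslates)
    (hLiu : ∀ (F : CMField) [IsGalois ℚ F] (h6 : 6 ≤ Module.finrank ℚ F) (Φ : CMType F) (ι₁ : F →+* ℂ), ι₁ ∈ Φ.1 →
      ∀ V : HermSpace3 F ι₁, Thm418AsPrintedC (C F ι₁ V Φ)
        (restOne (C F ι₁ V Φ) (AlgHom.id ℚ F) ι₁ (isConjugateSymplectic_muOfInvType ι₁ Φ) (hasWeight_one_muOfInvType ι₁ Φ) (Def45.Carriers.ofPolDR (muOfInvType ι₁ Φ) (P F ι₁ V Φ))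
          (Eps F ι₁ V Φ) (epsOf F ι₁ V Φ) (Chi F ι₁ V Φ) (omega F ι₁ V Φ) (rho F ι₁ V Φ) ((T F ι₁ V Φ h6).rhoΩOne (AlgHom.id ℚ F) ι₁ (isConjugateSymplectic_muOfInvType ι₁ Φ) (hasWeight_one_muOfInvType ι₁ Φ) (Def45.Carriers.ofPolDR (muOfInvType ι₁ Φ) (P F ι₁ V Φ)))))
    (hObj : ∀ (F : CMField) [IsGalois ℚ F], 6 ≤ Module.finrank ℚ F → ∀ (Φ : CMType F) (ι₁ : F →+* ℂ), ι₁ ∈ Φ.1 →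
      ∀ V : HermSpace3 F ι₁,
        Nonempty (Def45.CMDatum (AlgHom.id ℚ F) ι₁ (isConjugateSymplectic_muOfInvType ι₁ Φ) (hasWeight_one_muOfInvType ι₁ Φ) (Def45.Carriers.ofPolDR (muOfInvType ι₁ Φ) (P F ι₁ V Φ))))
    (hChi : ∀ (F : CMField), IsGalois ℚ F → 6 ≤ Module.finrank ℚ F → ∀ (Φ : CMType F) (ι₁ : F →+* ℂ), ι₁ ∈ Φ.1 →
      ∀ V : HermSpace3 F ι₁, Nonempty (Chi F ι₁ V Φ))
    (hirr : ∀ (F : CMField) [IsGalois ℚ F] (h6 : 6 ≤ Module.finrank ℚ F) (Φ : CMType F) (ι₁ : F →+* ℂ), ι₁ ∈ Φ.1 →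
      ∀ (V : HermSpace3 F ι₁)
        (i : (toThm418Data (C F ι₁ V Φ)
          (restOne (C F ι₁ V Φ) (AlgHom.id ℚ F) ι₁ (isConjugateSymplectic_muOfInvType ι₁ Φ) (hasWeight_one_muOfInvType ι₁ Φ) (Def45.Carriers.ofPolDR (muOfInvType ι₁ Φ) (P F ι₁ V Φ))
            (Eps F ι₁ V Φ) (epsOf F ι₁ V Φ) (Chi F ι₁ V Φ) (omega F ι₁ V Φ) (rho F ι₁ V Φ) ((T F ι₁ V Φ h6).rhoΩOne (AlgHom.id ℚ F) ι₁ (isConjugateSymplectic_muOfInvType ι₁ Φ) (hasWeight_one_muOfInvType ι₁ Φ) (Def45.Carriers.ofPolDR (muOfInvType ι₁ Φ) (P F ι₁ V Φ))))).AdmIndex),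
        (rho F ι₁ V Φ i.1.1 i.1.2).IsIrreducible)
    (hsm : ∀ (F : CMField) [IsGalois ℚ F] (h6 : 6 ≤ Module.finrank ℚ F) (Φ : CMType F) (ι₁ : F →+* ℂ), ι₁ ∈ Φ.1 →
      ∀ (V : HermSpace3 F ι₁)
        (i : (toThm418Data (C F ι₁ V Φ)
          (restOne (C F ι₁ V Φ) (AlgHom.id ℚ F) ι₁ (isConjugateSymplectic_muOfInvType ι₁ Φ) (hasWeight_one_muOfInvType ι₁ Φ) (Def45.Carriers.ofPolDR (muOfInvType ι₁ Φ) (P F ι₁ V Φ))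
            (Eps F ι₁ V Φ) (epsOf F ι₁ V Φ) (Chi F ι₁ V Φ) (omega F ι₁ V Φ) (rho F ι₁ V Φ) ((T F ι₁ V Φ h6).rhoΩOne (AlgHom.id ℚ F) ι₁ (isConjugateSymplectic_muOfInvType ι₁ Φ) (hasWeight_one_muOfInvType ι₁ Φ) (Def45.Carriers.ofPolDR (muOfInvType ι₁ Φ) (P F ι₁ V Φ))))).AdmIndex)
        (v : omega F ι₁ V Φ i.1.1 i.1.2),
        ∃ S : Subgroup (C F ι₁ V Φ).G, IsOpen (S : Set (C F ι₁ V Φ).G) ∧ ∀ k ∈ S, rho F ι₁ V Φ i.1.1 i.1.2 k v = v) :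
    let U := picardCMUniverse exists_isReal_hodgeModel_holds hodgePQ_independent_of_hodgeModel_holds
      BallQuotient.ballQuotientUniformised_holds cmAbelianVarietyRealised_holds
    let hU := ballQuotientUniformisedDatum_of BallQuotient.ballQuotientUniformised_holds
    (∀ (F : CMField), IsGalois ℚ F → 6 ≤ Module.finrank ℚ F → ∀ (f : Face F) (ι₁ : F →+* ℂ), f.Admissible ι₁ →
      ∀ V : HermSpace3 F ι₁,
      ∃ (H CG G SK SigIdx SigIdxG : Type) (_ : NormedAddCommGroup H) (_ : InnerProductSpace ℂ H) (_ : CompleteSpace H)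
        (_ : NormedAddCommGroup CG) (_ : NormedSpace ℂ CG) (_ : Group G) (_ : TopologicalSpace G) (_ : TopologicalSpace SK)
        (S : Perl34.IsolationSetting H (Lp ℂ 2 V.autMeasure) CG G SK SigIdx SigIdxG),
        (∀ (Γ : Level V) (ω₁ ω₂ : U.CohC (U.pms F ι₁ V Γ) 1),
          ω₁ ∈ U.Uiso Γ F (f.psi 0) ι₁ → ω₂ ∈ U.Uiso Γ F (f.psi 1) ι₁ →
            embOf exists_isReal_hodgeModel_holds hodgePQ_independent_of_hodgeModel_holds hU cmAbelianVarietyRealised_holds Γ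
                (U.cup2C (U.pms F ι₁ V Γ) 1 ω₁ ω₂) ≠ 0 →
              ∃ u ∈ S.t12.S12,
                ⟪embOf exists_isReal_hodgeModel_holds hodgePQ_independent_of_hodgeModel_holds hU cmAbelianVarietyRealised_holds Γ
                    (U.cup2C (U.pms F ι₁ V Γ) 1 ω₁ ω₂), u⟫_ℂ ≠ 0) ∧
        (∀ χ : S.t34.X, S.t34.allowed χ → ∀ (Φ : SK) (Γ₁ : Level V)
          (ω₁ ω₂ : U.CohC (U.pms F ι₁ V Γ₁) 1),
          ω₁ ∈ U.Uiso Γ₁ F (f.psi 0) ι₁ →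
          ω₂ ∈ U.Uiso Γ₁ F (f.psi 1) ι₁ →
            ⟪embOf exists_isReal_hodgeModel_holds hodgePQ_independent_of_hodgeModel_holds hU cmAbelianVarietyRealised_holds Γ₁
                (U.cup2C (U.pms F ι₁ V Γ₁) 1 ω₁ ω₂),
              S.t34.ϑ χ Φ⟫_ℂ ≠ 0 →
              ∃ (Γ : Level V) (ω : Fin 4 → U.CohC (U.pms F ι₁ V Γ) 1),
                (∀ i, ω i ∈ U.Uiso Γ F (f.psi i) ι₁) ∧
                  ⟪embOf exists_isReal_hodgeModel_holds hodgePQ_independent_of_hodgeModel_holds hU cmAbelianVarietyRealised_holds Γ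
                      (U.cup2C (U.pms F ι₁ V Γ) 1 (ω 2) (ω 3)),
                    embOf exists_isReal_hodgeModel_holds hodgePQ_independent_of_hodgeModel_holds hU cmAbelianVarietyRealised_holds Γ
                      (U.cup2C (U.pms F ι₁ V Γ) 1 (ω 0) (ω 1))⟫_ℂ
                    ≠ 0)) →
    HC_CM :=
  fun hM ↦ hc_cm_of_supply_of_settingMeetSat_embOf exists_isReal_hodgeModel_holds hodgePQ_independent_of_hodgeModel_holds
    BallQuotient.ballQuotientUniformised_holds cmAbelianVarietyRealised_holds deligneMilne1982_Thm_6_20_full_holds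
    (faceSupply_of_thm418AsPrinted_along_conj_holds_restOne_hecke _ _ _ _ h hA iso C P Eps epsOf Chi omega rho T hLiu hObj hChi hirr hsm) hM

end MeetingFormHecke

end Summit.HodgeConjecture.CorCM.Model

end
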